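import Literature.NumberTheory.Automorphic.FuchsianEichlerShimuraWeightTwo
import HarnessLib

/-!
# Crux NUM `CartanOnePlaceDegreeLawAtThree` (item 24801), line `lattice` v13 — the print clauses (ESᶜ), (SIGᶜ) I: no parabolic elements and no cusps in
# `ι(O¹)` for a DIVISION algebra; clause (SIGᶜ)(i) from finite generation

Seat `bsd-stepL-tam3-p1` g29 (LEAD of crux 24801; `--supports stmt-BirchSwinnertonDyer-24801 --as helper`). The registered line `Lines/lattice.lean` v13 is
closed modulo ONE pure-cite stub of eight print facts, among them (ESᶜ) `Literature.NumberTheory.Automorphic.eichlerShimura_weightTwo_rePeriod` (Shimura Thm. 8.4: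
`φ : S₂(Γ) → H¹_P(Γ, ℝ)` is injective AND surjective) and (SIGᶜ) `…parabolicCochain_free_and_modLift` ((i) `Hom_par(Γ, ℤ)` has a finite `ℤ`-basis; (ii) torsion-
and parabolic-null cochains mod `n` lift), both stated for `Γ = normOneUnits ι hO = ι(O¹)`, `O` ANY order of ANY quaternion algebra `B` over `ℚ` with a real
splitting `ι`. This file and its sequel `…CartanCoverPrintClausesCocompact` PROVE, sorry-free, the parts of these clauses that are NOT deep print:

* §1 (any `B` whose non-zero elements are units — a division algebra, e.g. `disc B > 1`): `ι(O¹)` has NO PARABOLIC ELEMENT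
  (`not_isParabolic_of_mem_normOneUnits`: a parabolic `γ = ι(x)` of determinant `1` has `(γ ∓ 1)² = 0`, `γ ≠ ±1`, so `(x ∓ 1)² = 0` with `x ∓ 1 ≠ 0` a unit —
  absurd) and hence NO CUSP (`not_isCusp_normOneUnits`; Mathlib's `IsCusp c Γ` = `c` is fixed by a parabolic element of `Γ`). Consequently every
  «parabolic-null» hypothesis ∕ conclusion in (ESᶜ) and (SIGᶜ) is VACUOUS at a division algebra (`esSurjClause_iff_of_forall_isUnit`,
  `sigLiftClause_iff_of_forall_isUnit`): what (ESᶜ)-surjectivity says there is «every additive `u : Γ → ℝ` is a real period cochain», and what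
  (SIGᶜ)(ii) says is «every additive `ψ : Γ → ZMod n` killing the elements of finite order lifts to an additive `u : Γ → ℤ`».
* §2 (any group): clause (SIGᶜ)(i) is FINITE GENERATION — for a finitely generated group `G` and any predicate `P`, the additive `P`-null cochains
  `G → ℤ` have a finite `ℤ`-basis in exactly the unbundled form of (SIGᶜ)(i) (`exists_fin_basis_addCochain_of_fg`: they form a `ℤ`-submodule of `G → ℤ` that
  embeds, by evaluation on a finite generating set, into `ℤ^T`; a finitely generated torsion-free `ℤ`-module is free). Hence (SIGᶜ)(i) holds for every
  `(B, O, ι)` with `ι(O¹)` finitely generated (`sigBasisClause_of_fg`); the sequel supplies finite generation for cocompact `ι(O¹)` and for the cover groups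
  `ι(O₀'¹)` of a Cartan datum at `D > 1`, together with the injectivity half of (ESᶜ) there.

WHAT REMAINS PRINT (honest): (ESᶜ)-SURJECTIVITY (Hodge theory; for `D > 1` reachable in-tree through `Literature.Geometry.Kaehler.RiemannSurface…`
`existsUnique_re_period_eq` once `Γ(3)∖ℍ` is available as a compact Riemann surface with its quotient covering — not done here), (SIGᶜ)(ii) (Armstrong ∕ the
Fuchsian presentation), and everything at `D = 1` (cusps). Nothing is proved about NUM, 24801, 23422, 19109 or any curve; BSD is proved for no curve.
[cite: ShimuraIATAF1971, Thm. 8.4 p. 234, Prop. 8.6, §9.2 p. 246] [cite: Beardon1983, Thm. 10.3.2] [cite: Iwaniec2002, Ch. 2 Prop. 2.3]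
-/

set_option linter.dupNamespace false
set_option autoImplicit false

noncomputable section

open scoped MatrixGroups ModularForm
open UpperHalfPlane Function Set

namespace Summit.BirchSwinnertonDyer.BirchSwinnertonDyer.Theorems.CartanCover.PrintClauses

open Literature.NumberTheory.Automorphic

/-! ## §1 No parabolic elements and no cusps in `ι(O¹)` for a division algebra -/

section Division

variable {B : Type*} [Ring B] [Algebra ℚ B] (ι : B →ₐ[ℚ] Matrix (Fin 2) (Fin 2) ℝ) {O : Submodule ℤ B} (hO : Brandt.IsOrder B O)

omit [Algebra ℚ B] in
/-- In a non-trivial ring whose non-zero elements are units, `y² = 0 ⇒ y = 0`. [folklore] -/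
theorem eq_zero_of_sq_eq_zero_of_forall_isUnit [Nontrivial B] (hdiv : ∀ x : B, x ≠ 0 → IsUnit x) {y : B}
    (hy : y ^ 2 = 0) : y = 0 := by
  by_contra h
  exact ((hdiv y h).pow 2).ne_zero hy

/-- A ring mapping to `M₂(ℝ)` by a ring map is non-trivial. [folklore] -/
theorem nontrivial_of_algHom (ι : B →ₐ[ℚ] Matrix (Fin 2) (Fin 2) ℝ) : Nontrivial B :=
  nontrivial_of_ne 0 1 fun h => by
    have h1 : ι 0 = ι 1 := congrArg ι h
    rw [map_zero, map_one] at h1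
    exact zero_ne_one h1

/-- **`ι(O¹)` has no parabolic elements when `B` is a division algebra.** A parabolic `γ` has `discr γ = tr(γ)² − 4 det γ = 0`; with `det γ = 1`,
`tr γ = ±2`, the parabolic eigenvalue is `±1` and `(γ ∓ 1)² = 0` (Mathlib `IsParabolic.sub_eigenvalue_sq_eq_zero`); writing `γ = ι(x)`, `x ∈ O`, gives
`ι((x ∓ 1)²) = 0`, so `(x ∓ 1)² = 0`, so `x = ±1` (division algebra) and `γ = ±1` is scalar — but parabolic elements are non-scalar.
[cite: ShimuraIATAF1971, §9.2 p. 246 («Γ'∖ℌ is compact unless B is isomorphic to M₂(Q)»)] [cite: PastenShimura2024, §4.3 p. 14] -/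
theorem not_isParabolic_of_mem_normOneUnits (hι : Function.Injective ι) (hdiv : ∀ x : B, x ≠ 0 → IsUnit x)
    {γ : GL (Fin 2) ℝ} (hγ : γ ∈ normOneUnits ι hO) : ¬ γ.IsParabolic := by
  haveI : Nontrivial B := nontrivial_of_algHom ι
  intro hpar
  obtain ⟨⟨x, -, hx⟩, -, hdet⟩ := hγ
  have hdet' : (γ : Matrix (Fin 2) (Fin 2) ℝ).det = 1 := by
    rw [← Matrix.GeneralLinearGroup.val_det_apply, hdet, Units.val_one]
  have hdisc := hpar.2
  rw [Matrix.discr_fin_two, hdet'] at hdisc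
  have ht : (γ : Matrix (Fin 2) (Fin 2) ℝ).trace ^ 2 = 2 ^ 2 := by linear_combination hdisc
  have hsq := hpar.sub_eigenvalue_sq_eq_zero
  have hns := hpar.1
  rcases sq_eq_sq_iff_eq_or_eq_neg.mp ht with h2 | h2
  · -- eigenvalue `1`: `(γ - 1)² = 0`
    have hev : (γ : Matrix (Fin 2) (Fin 2) ℝ).parabolicEigenvalue = 1 := by
      rw [Matrix.parabolicEigenvalue, h2]; norm_num
    rw [hev, map_one, ← hx] at hsq
    have h0 : ι ((x - 1) ^ 2) = ι 0 := by rw [map_pow, map_sub, map_one, hsq, map_zero]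
    have hx1 : x - 1 = 0 := eq_zero_of_sq_eq_zero_of_forall_isUnit hdiv (hι h0)
    have hx1' : x = 1 := sub_eq_zero.mp hx1
    exact hns ⟨1, by rw [map_one, ← hx, hx1', map_one]⟩
  · -- eigenvalue `-1`: `(γ + 1)² = 0`
    have hev : (γ : Matrix (Fin 2) (Fin 2) ℝ).parabolicEigenvalue = -1 := by
      rw [Matrix.parabolicEigenvalue, h2]; norm_num
    rw [hev, map_neg, map_one, ← hx, sub_neg_eq_add] at hsq
    have h0 : ι ((x + 1) ^ 2) = ι 0 := by rw [map_pow, map_add, map_one, hsq, map_zero]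
    have hx1 : x + 1 = 0 := eq_zero_of_sq_eq_zero_of_forall_isUnit hdiv (hι h0)
    have hx1' : x = -1 := eq_neg_of_add_eq_zero_left hx1
    exact hns ⟨-1, by rw [map_neg, map_one, ← hx, hx1', map_neg, map_one]⟩

/-- **`ι(O¹)` has no cusps when `B` is a division algebra** (Mathlib: `IsCusp c Γ` iff some parabolic element of `Γ` fixes `c`), so the cusp conditions of
`CuspForm (normOneUnits ι hO) k` are vacuous. [cite: ShimuraIATAF1971, §9.2 p. 246] [cite: PastenShimura2024, §4.6 p. 15] -/
theorem not_isCusp_normOneUnits (hι : Function.Injective ι) (hdiv : ∀ x : B, x ≠ 0 → IsUnit x) (c : OnePoint ℝ) :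
    ¬ IsCusp c (normOneUnits ι hO) := by
  rintro ⟨γ, hγ, hpar, -⟩
  exact not_isParabolic_of_mem_normOneUnits ι hO hι hdiv hγ hpar

/-- **At a division algebra the surjectivity clause of (ESᶜ) is «every additive real cochain is a real period cochain»**: the parabolic-null hypothesis
on `u` is vacuous. [cite: ShimuraIATAF1971, Thm. 8.4 p. 234] -/
theorem esSurjClause_iff_of_forall_isUnit (hι : Function.Injective ι) (hdiv : ∀ x : B, x ≠ 0 → IsUnit x) (z₀ : ℍ) :
    (∀ u : normOneUnits ι hO → ℝ,
        (∀ γ δ : normOneUnits ι hO, u (γ * δ) = u γ + u δ) →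
        (∀ γ : normOneUnits ι hO, (γ : GL (Fin 2) ℝ).IsParabolic → u γ = 0) →
        ∃ F : CuspForm (normOneUnits ι hO) 2, ∀ γ : normOneUnits ι hO, CuspForm.rePeriod F z₀ γ = u γ) ↔
    (∀ u : normOneUnits ι hO → ℝ,
        (∀ γ δ : normOneUnits ι hO, u (γ * δ) = u γ + u δ) →
        ∃ F : CuspForm (normOneUnits ι hO) 2, ∀ γ : normOneUnits ι hO, CuspForm.rePeriod F z₀ γ = u γ) := by
  constructor
  · intro h u hu
    exact h u hu fun γ hγ => absurd hγ (not_isParabolic_of_mem_normOneUnits ι hO hι hdiv γ.2)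
  · intro h u hu _
    exact h u hu

/-- **At a division algebra clause (SIGᶜ)(ii) is «every additive `ψ : Γ → ZMod n` killing the elements of finite order lifts to an additive `u : Γ → ℤ`»**:
all parabolic clauses are vacuous. [cite: Beardon1983, Thm. 10.3.2] [cite: ShimuraIATAF1971, §9.2 p. 246] -/
theorem sigLiftClause_iff_of_forall_isUnit (hι : Function.Injective ι) (hdiv : ∀ x : B, x ≠ 0 → IsUnit x) (n : ℕ) :
    (∀ ψ : normOneUnits ι hO → ZMod n,
        (∀ γ δ : normOneUnits ι hO, ψ (γ * δ) = ψ γ + ψ δ) →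
        (∀ γ : normOneUnits ι hO, IsOfFinOrder γ → ψ γ = 0) →
        (∀ γ : normOneUnits ι hO, (γ : GL (Fin 2) ℝ).IsParabolic → ψ γ = 0) →
        ∃ u : normOneUnits ι hO → ℤ,
          (∀ γ δ : normOneUnits ι hO, u (γ * δ) = u γ + u δ) ∧
          (∀ γ : normOneUnits ι hO, (γ : GL (Fin 2) ℝ).IsParabolic → u γ = 0) ∧
          ∀ γ : normOneUnits ι hO, (u γ : ZMod n) = ψ γ) ↔
    (∀ ψ : normOneUnits ι hO → ZMod n,
        (∀ γ δ : normOneUnits ι hO, ψ (γ * δ) = ψ γ + ψ δ) →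
        (∀ γ : normOneUnits ι hO, IsOfFinOrder γ → ψ γ = 0) →
        ∃ u : normOneUnits ι hO → ℤ,
          (∀ γ δ : normOneUnits ι hO, u (γ * δ) = u γ + u δ) ∧ ∀ γ : normOneUnits ι hO, (u γ : ZMod n) = ψ γ) := by
  have hnp : ∀ γ : normOneUnits ι hO, ¬ (γ : GL (Fin 2) ℝ).IsParabolic :=
    fun γ => not_isParabolic_of_mem_normOneUnits ι hO hι hdiv γ.2
  constructor
  · intro h ψ hψ htors
    obtain ⟨u, hu, -, hred⟩ := h ψ hψ htors fun γ hγ => absurd hγ (hnp γ)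
    exact ⟨u, hu, hred⟩
  · intro h ψ hψ htors _
    obtain ⟨u, hu, hred⟩ := h ψ hψ htors
    exact ⟨u, hu, fun γ hγ => absurd hγ (hnp γ), hred⟩

end Division

/-! ## §2 Clause (SIGᶜ)(i) is finite generation: additive `P`-null cochains of a finitely generated group have a finite `ℤ`-basis -/

section Basis

/-- Two additive maps `G → ℤ` that agree on a generating set agree. [folklore] -/
theorem addCochain_eq_of_eqOn_closure {G : Type*} [Group G] {T : Set G} (hT : Subgroup.closure T = ⊤) {u v : G → ℤ}
    (hu : ∀ γ δ : G, u (γ * δ) = u γ + u δ) (hv : ∀ γ δ : G, v (γ * δ) = v γ + v δ) (h : ∀ t ∈ T, u t = v t) : u = v := by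
  let fu : G →* Multiplicative ℤ := MonoidHom.mk' (fun γ => Multiplicative.ofAdd (u γ)) fun a b => by
    rw [hu, ofAdd_add]
  let fv : G →* Multiplicative ℤ := MonoidHom.mk' (fun γ => Multiplicative.ofAdd (v γ)) fun a b => by
    rw [hv, ofAdd_add]
  have hfg : fu = fv := MonoidHom.eq_of_eqOn_dense hT fun t ht => by
    show Multiplicative.ofAdd (u t) = Multiplicative.ofAdd (v t)
    rw [h t ht]
  funext γ
  have h1 : fu γ = fv γ := by rw [hfg]
  exact Multiplicative.ofAdd.injective h1

/-- **Clause (SIGᶜ)(i) from finite generation.** For a finitely generated group `G` and any predicate `P` on `G`, the additive maps `u : G → ℤ` vanishing on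
`P` have a finite `ℤ`-basis `e₁, …, e_r`: each `e_i` is additive and `P`-null, and every such `u` is `Σ c_i e_i` for a unique `c ∈ ℤ^r`. (They form a
`ℤ`-submodule of `G → ℤ` which embeds into `ℤ^T`, `T` a finite generating set, by evaluation; a finitely generated torsion-free `ℤ`-module is free of finite
rank.) This is the part of the «signature» statement that does not need the Fuchsian presentation. [cite: ShimuraIATAF1971, Prop. 8.6 («Γ has a finite set of generators»)]
[cite: Iwaniec2002, Ch. 2 Prop. 2.3] -/
theorem exists_fin_basis_addCochain_of_fg (G : Type*) [Group G] [Group.FG G] (P : G → Prop) :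
    ∃ (r : ℕ) (e : Fin r → (G → ℤ)),
      (∀ i, (∀ γ δ : G, e i (γ * δ) = e i γ + e i δ) ∧ (∀ γ : G, P γ → e i γ = 0)) ∧
      ∀ u : G → ℤ, (∀ γ δ : G, u (γ * δ) = u γ + u δ) → (∀ γ : G, P γ → u γ = 0) →
        ∃! c : Fin r → ℤ, u = fun γ => ∑ i, c i * e i γ := by
  classical
  -- the submodule of additive `P`-null cochains
  let S : Submodule ℤ (G → ℤ) :=
    { carrier := {u | (∀ γ δ : G, u (γ * δ) = u γ + u δ) ∧ ∀ γ : G, P γ → u γ = 0}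
      add_mem' := by
        rintro u v ⟨hu, hu'⟩ ⟨hv, hv'⟩
        refine ⟨fun γ δ => ?_, fun γ hγ => ?_⟩
        · simp only [Pi.add_apply, hu, hv]; ring
        · simp only [Pi.add_apply, hu' γ hγ, hv' γ hγ, add_zero]
      zero_mem' := ⟨fun _ _ => by simp, fun _ _ => rfl⟩
      smul_mem' := by
        rintro c u ⟨hu, hu'⟩
        refine ⟨fun γ δ => ?_, fun γ hγ => ?_⟩
        · simp only [Pi.smul_apply, smul_eq_mul, hu]; ring
        · simp only [Pi.smul_apply, smul_eq_mul, hu' γ hγ, mul_zero] }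
  have hSmem : ∀ u : G → ℤ, u ∈ S ↔ (∀ γ δ : G, u (γ * δ) = u γ + u δ) ∧ ∀ γ : G, P γ → u γ = 0 := fun u => Iff.rfl
  -- a finite generating set
  obtain ⟨T, hT⟩ := Group.fg_def.mp ‹Group.FG G›
  -- evaluation on `T`
  let ev : S →ₗ[ℤ] (T → ℤ) :=
    { toFun := fun u t => (u : G → ℤ) t
      map_add' := fun u v => rfl
      map_smul' := fun c u => rfl }
  have hev : Function.Injective ev := by
    intro u v huv
    apply Subtype.ext
    exact addCochain_eq_of_eqOn_closure hT u.2.1 v.2.1 fun t ht => congr_fun huv ⟨t, ht⟩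
  haveI : Module.Finite ℤ S := Module.Finite.of_injective ev hev
  haveI : Module.Free ℤ S := Module.free_of_finite_type_torsion_free'
  let b := Module.finBasis ℤ S
  refine ⟨Module.finrank ℤ S, fun i => ((b i : S) : G → ℤ), fun i => (b i).2, fun u hu hP => ?_⟩
  let us : S := ⟨u, (hSmem u).mpr ⟨hu, hP⟩⟩
  -- coordinates in the basis
  have hexp : ∀ c : Fin (Module.finrank ℤ S) → ℤ,
      (((b.equivFun.symm c : S) : G → ℤ)) = fun γ => ∑ i, c i * ((b i : S) : G → ℤ) γ := by
    intro c
    rw [Module.Basis.equivFun_symm_apply, Submodule.coe_sum]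
    funext γ
    simp only [Submodule.coe_smul, Finset.sum_apply, Pi.smul_apply, smul_eq_mul]
  refine ⟨b.equivFun us, ?_, fun c hc => ?_⟩
  · have h1 : b.equivFun.symm (b.equivFun us) = us := b.equivFun.symm_apply_apply us
    have h2 := hexp (b.equivFun us)
    rw [h1] at h2
    exact h2
  · have h1 : (us : G → ℤ) = ((b.equivFun.symm c : S) : G → ℤ) := by rw [hexp c]; exact hc
    have h2 : us = b.equivFun.symm c := Subtype.ext h1
    rw [h2, LinearEquiv.apply_symm_apply]

/-- **(SIGᶜ)(i) for `Γ = ι(O¹)` finitely generated**: the additive parabolic-null maps `Γ → ℤ` have a finite `ℤ`-basis — the first conjunct of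
`parabolicCochain_free_and_modLift` at `(B, O, ι)`, VERBATIM, from `Group.FG Γ`. [cite: Iwaniec2002, Ch. 2 Prop. 2.3 and Prop. 2.6] -/
theorem sigBasisClause_of_fg {B : Type*} [Ring B] [Algebra ℚ B] (ι : B →ₐ[ℚ] Matrix (Fin 2) (Fin 2) ℝ) {O : Submodule ℤ B}
    (hO : Brandt.IsOrder B O) [Group.FG (normOneUnits ι hO)] :
    ∃ (r : ℕ) (e : Fin r → (normOneUnits ι hO → ℤ)),
      (∀ i, (∀ γ δ : normOneUnits ι hO, e i (γ * δ) = e i γ + e i δ) ∧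
        (∀ γ : normOneUnits ι hO, (γ : GL (Fin 2) ℝ).IsParabolic → e i γ = 0)) ∧
      ∀ u : normOneUnits ι hO → ℤ,
        (∀ γ δ : normOneUnits ι hO, u (γ * δ) = u γ + u δ) →
        (∀ γ : normOneUnits ι hO, (γ : GL (Fin 2) ℝ).IsParabolic → u γ = 0) →
        ∃! c : Fin r → ℤ, u = fun γ => ∑ i, c i * e i γ :=
  exists_fin_basis_addCochain_of_fg (normOneUnits ι hO) fun γ => (γ : GL (Fin 2) ℝ).IsParabolic

end Basis

end Summit.BirchSwinnertonDyer.BirchSwinnertonDyer.Theorems.CartanCover.PrintClauses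

end
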